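import Literature.Topology.FourManifolds.RegularValuePreimage
import Mathlib.Analysis.InnerProductSpace.PiL2
import Mathlib.Analysis.Calculus.MeanValue
import HarnessLib

/-!
# The plane push `T_θ(w) = w + ρ(w) θ`

Topic `Literature/Topology/FourManifolds` (programme of the fact
`Literature.Topology.FourManifolds.exists_isSimplifiedBrokenLefschetzFibration`, Baykur–Saeki 2017, §2.1,
§3).  For a `C^∞` function `ρ : ℝ² → ℝ` with `‖dρ‖ ≤ C` and a vector `θ ∈ ℝ²` with
`C ‖θ‖ < 1`, the map `T_θ(w) = w + ρ(w) θ` is an injective local diffeomorphism of the plane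
(a diffeomorphism onto its open image): `dT_θ = id + θ ⊗ dρ` is invertible, and
`T_θ w = T_θ w'` forces `‖w - w'‖ ≤ C ‖θ‖ ‖w - w'‖`.  Composing a map into a surface with
`ψ⁻¹ ∘ T_θ ∘ ψ` (`ψ` a chart) is how pieces of fold image are isotoped (`GeneralPush`).

* `PlanePush.T`, `hasFDerivAt_T`, `bijective_TDeriv`, `injective_T`, `exists_localInverse_T`.

Everything is proved; `T` and its differential are the only definitions; no named facts
(D-0026).

## References

* R. İ. Baykur, O. Saeki, *Simplifying indefinite fibrations on 4-manifolds*, arXiv:1705.11169,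
  §2.1, §3. [BaykurSaeki2017]
* M. Golubitsky, V. Guillemin, *Stable Mappings and Their Singularities*, GTM 14 (1973), Ch. I
  §1 (inverse function theorem). [GolubitskyGuillemin1973]
-/

noncomputable section

open Set Function Filter Module Metric
open scoped ContDiff Topology

namespace Literature.Topology.FourManifolds

/-- Local notation: `𝔼 n` is the model Euclidean space `EuclideanSpace ℝ (Fin n)`. -/
local notation "𝔼 " n:arg => EuclideanSpace ℝ (Fin n)

namespace PlanePush

variable (ρ : 𝔼 2 → ℝ)

/-- **The plane push** `T_θ(w) = w + ρ(w) θ`. [cite: BaykurSaeki2017, §3] -/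
def T (θ : 𝔼 2) (w : 𝔼 2) : 𝔼 2 := w + ρ w • θ

/-- The differential `id + θ ⊗ dρ(w)`. [folklore] -/
def TDeriv (θ : 𝔼 2) (w : 𝔼 2) : 𝔼 2 →L[ℝ] 𝔼 2 :=
  ContinuousLinearMap.id ℝ (𝔼 2) + (fderiv ℝ ρ w).smulRight θ

/-- `TDeriv ρ θ w v = v + dρ(w)(v) θ`. [folklore] -/
@[simp] theorem TDeriv_apply (θ w v : 𝔼 2) : TDeriv ρ θ w v = v + (fderiv ℝ ρ w v) • θ := by
  simp [TDeriv, ContinuousLinearMap.smulRight_apply]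

variable {ρ}

/-- `T_θ` is `C^∞`. [folklore] -/
theorem contDiff_T (hρ : ContDiff ℝ ∞ ρ) (θ : 𝔼 2) : ContDiff ℝ ∞ (T ρ θ) :=
  contDiff_id.add (hρ.smul contDiff_const)

/-- The differential of `T_θ`. [folklore] -/
theorem hasFDerivAt_T (hρ : ContDiff ℝ ∞ ρ) (θ w : 𝔼 2) :
    HasFDerivAt (T ρ θ) (TDeriv ρ θ w) w :=
  (hasFDerivAt_id w).add (((hρ.differentiable (by simp)) w).hasFDerivAt.smul_const θ)

/-- **`dT_θ(w)` is invertible when `C ‖θ‖ < 1`**, `C` a bound for `‖dρ‖`. [folklore] -/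
theorem bijective_TDeriv {C : ℝ} (hC : ∀ w, ‖fderiv ℝ ρ w‖ ≤ C) {θ : 𝔼 2} (hθ : C * ‖θ‖ < 1)
    (w : 𝔼 2) : Bijective (TDeriv ρ θ w) := by
  have hinj : Injective (TDeriv ρ θ w) := by
    intro v v' hvv'
    rw [← sub_eq_zero] at hvv' ⊢
    rw [← map_sub] at hvv'
    set u := v - v' with hu
    rw [TDeriv_apply] at hvv'
    have h1 : u = -((fderiv ℝ ρ w u) • θ) := eq_neg_of_add_eq_zero_left hvv'
    have h1' : ‖u‖ = ‖(fderiv ℝ ρ w u) • θ‖ := by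
      conv_lhs => rw [h1]
      rw [norm_neg]
    have h2 : ‖u‖ ≤ C * ‖θ‖ * ‖u‖ := by
      calc ‖u‖ = ‖(fderiv ℝ ρ w u) • θ‖ := h1'
        _ = |fderiv ℝ ρ w u| * ‖θ‖ := by rw [norm_smul, Real.norm_eq_abs]
        _ ≤ (‖fderiv ℝ ρ w‖ * ‖u‖) * ‖θ‖ := by
            gcongr; exact (fderiv ℝ ρ w).le_opNorm u
        _ ≤ (C * ‖u‖) * ‖θ‖ := by gcongr; exact hC w
        _ = C * ‖θ‖ * ‖u‖ := by ring
    by_contra hne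
    have hpos : 0 < ‖u‖ := norm_pos_iff.2 hne
    nlinarith
  exact ⟨hinj, LinearMap.surjective_of_injective (f := (TDeriv ρ θ w).toLinearMap) hinj⟩

/-- **`T_θ` is injective when `C ‖θ‖ < 1`.** [folklore] -/
theorem injective_T (hρ : ContDiff ℝ ∞ ρ) {C : ℝ} (hC : ∀ w, ‖fderiv ℝ ρ w‖ ≤ C) {θ : 𝔼 2}
    (hθ : C * ‖θ‖ < 1) : Injective (T ρ θ) := by
  intro w w' hww'
  simp only [T] at hww'
  have h1 : w - w' = (ρ w' - ρ w) • θ := by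
    rw [sub_smul]
    linear_combination (norm := module) hww'
  have hρd : ∀ z, DifferentiableAt ℝ ρ z := fun z => (hρ.differentiable (by simp)) z
  have h2 : ‖ρ w' - ρ w‖ ≤ C * ‖w' - w‖ :=
    (convex_univ).norm_image_sub_le_of_norm_fderiv_le (fun z _ => hρd z) (fun z _ => hC z)
      (mem_univ w) (mem_univ w')
  have h3 : ‖w - w'‖ ≤ C * ‖θ‖ * ‖w - w'‖ := by
    calc ‖w - w'‖ = ‖(ρ w' - ρ w) • θ‖ := by rw [h1]
      _ = ‖ρ w' - ρ w‖ * ‖θ‖ := norm_smul _ _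
      _ ≤ C * ‖w' - w‖ * ‖θ‖ := by gcongr
      _ = C * ‖θ‖ * ‖w - w'‖ := by rw [norm_sub_rev]; ring
  by_contra hne
  have hpos : 0 < ‖w - w'‖ := norm_pos_iff.2 (sub_ne_zero.2 hne)
  nlinarith

/-- **`T_θ` is a local diffeomorphism at every point when `C ‖θ‖ < 1`** (inverse function
theorem). [cite: GolubitskyGuillemin1973, Ch. I §1] -/
theorem exists_localInverse_T (hρ : ContDiff ℝ ∞ ρ) {C : ℝ} (hC : ∀ w, ‖fderiv ℝ ρ w‖ ≤ C)
    {θ : 𝔼 2} (hθ : C * ‖θ‖ < 1) (w : 𝔼 2) :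
    ∃ G : OpenPartialHomeomorph (𝔼 2) (𝔼 2), ⇑G = T ρ θ ∧ w ∈ G.source ∧
      ContDiffOn ℝ ∞ G G.source ∧ ContDiffOn ℝ ∞ G.symm G.target := by
  have hbij := bijective_TDeriv hC hθ w
  set L : (𝔼 2) ≃L[ℝ] 𝔼 2 :=
    (LinearMap.linearEquivOfInjective ((TDeriv ρ θ w : 𝔼 2 →L[ℝ] 𝔼 2) : 𝔼 2 →ₗ[ℝ] 𝔼 2)
      hbij.1 rfl).toContinuousLinearEquiv with hL
  have hLc : (L : 𝔼 2 →L[ℝ] 𝔼 2) = TDeriv ρ θ w := ContinuousLinearMap.ext fun _ => rfl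
  have hd : HasFDerivAt (T ρ θ) (L : 𝔼 2 →L[ℝ] 𝔼 2) w := by
    rw [hLc]; exact hasFDerivAt_T hρ θ w
  obtain ⟨G, hG, hw, -, hGs, hGss⟩ := exists_openPartialHomeomorph_contDiffOn_symm isOpen_univ
    (mem_univ w) (by simp) (contDiff_T hρ θ).contDiffOn L hd
  exact ⟨G, hG, hw, hGs, hGss⟩

/-- A smooth compactly supported `ρ` has bounded differential. [folklore] -/
theorem exists_bound_fderiv (hρ : ContDiff ℝ ∞ ρ) (hρs : HasCompactSupport ρ) :
    ∃ C, 0 ≤ C ∧ ∀ w, ‖fderiv ℝ ρ w‖ ≤ C := by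
  obtain ⟨C, hC⟩ := (hρ.continuous_fderiv (by simp)).norm.bddAbove_range_of_hasCompactSupport
    (hρs.fderiv (𝕜 := ℝ)).norm
  refine ⟨max C 0, le_max_right _ _, fun w => (le_max_left C 0).trans' ?_⟩
  exact hC ⟨w, rfl⟩

end PlanePush

end Literature.Topology.FourManifolds
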